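import Literature.AnabelianGeometry.SemiGraphs.SemiGraph
import HarnessLib

/-!
# A combinatorial NON-SEPARATION criterion for edges of a semi-graph ([SemiAnbd] §1 p. 11, Cor. 2.7 (i) p. 30)

Mochizuki, *Semi-graphs of anabelioids*, Publ. RIMS **42** (2006), §1 p. 11 (semi-graphs: branches,
`edgeOf`, coincidence maps) and §2, proof of Cor. 2.7 (i) p. 30 ("[as one verifies immediately] `ℋ′`
injects into `𝒢′` as a subgraph") [cite: MochizukiSemiAnbd2006, Cor. 2.7(i) p.30].  PROOF-ONLY, PURE
COMBINATORICS (abc-iut cell, layer L3; FACT-LIST row F-1487, CLASS route, brick R6a PORT PRODUCTION (c);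
seat abc-iut-f-161 gen 12).  No definition, no instance, no named fact.  "The edge of the branch `bc` is
NON-SEPARATING" is spelled as in the port clause of `covering_subgraphComponents_doubleCosets_of_connectedPorts`
(`SubgraphComponentsDoubleCosetsOfPorts.lean`): the twin `bc₁` abuts to a vertex reached from the vertex
of `bc` by incidences avoiding `bc` (`Relation.ReflTransGen`).  `P` marks ALLOWED edges; `W` is a finite
set of vertices receiving every allowed branch.
* `exists_nonseparating_of_two_branches` — ROOTED MIN-DEGREE CRITERION: a root of allowed degree ≥ 1, all
  other vertices of `W` of allowed degree ≥ 2 ⇒ SOME allowed edge is two-sided and non-separating;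
* `reflTransGen_avoiding_map` — transport of avoiding walks along `edgeOf`/`abuts`-compatible maps;
* `nonseparating_of_two_branches_of_transitive` — allowed degree ≥ 2 on `W` + such maps TRANSITIVE on the
  allowed edges ⇒ EVERY two-sided allowed edge is non-separating (called at `S = 𝔾_Y` by the port producer).
Nothing here takes a side on [IUTchIII] Cor. 3.12.
-/

namespace Literature.AnabelianGeometry.SemiGraphs.SemiGraph

universe u

variable (S : SemiGraph.{u})

/-- The branches of the edge of `bc` are `bc` and its twin `bc₁`. [cite: MochizukiSemiAnbd2006, §1 p.11] -/
private theorem eq_or_eq_twin_of_edgeOf_eq {bc bc₁ b : S.Branch} (hne : bc₁ ≠ bc)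
    (he : S.edgeOf bc₁ = S.edgeOf bc) (hb : S.edgeOf b = S.edgeOf bc) : b = bc ∨ b = bc₁ := by
  obtain ⟨b₁, b₂, h12, h₁, h₂, hall⟩ := S.two_branches (S.edgeOf bc)
  rcases hall bc rfl with rfl | rfl <;> rcases hall bc₁ he with h | h <;>
    rcases hall b hb with h' | h' <;> subst_vars <;> simp_all

/-- Every branch has a twin: the other branch of its edge. [cite: MochizukiSemiAnbd2006, §1 p.11] -/
private theorem exists_twin (bc : S.Branch) : ∃ bc₁ : S.Branch, bc₁ ≠ bc ∧ S.edgeOf bc₁ = S.edgeOf bc := by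
  obtain ⟨b₁, b₂, h12, h₁, h₂, hall⟩ := S.two_branches (S.edgeOf bc)
  rcases hall bc rfl with rfl | rfl
  exacts [⟨b₂, h12.symm, h₂⟩, ⟨b₁, h12, h₁⟩]

/-- The avoiding-walk relation is symmetric. [cite: MochizukiSemiAnbd2006, §1 p.11] -/
private theorem symm_avoiding (bc : S.Branch) :
    Std.Symm (fun x y : S.Vertex => ∃ b b' : S.Branch,
      b ≠ bc ∧ b' ≠ bc ∧ S.edgeOf b = S.edgeOf b' ∧ S.abuts b = some x ∧ S.abuts b' = some y) :=
  ⟨fun _ _ ⟨b, b', hb, hb', he, hx, hy⟩ => ⟨b', b, hb', hb, he.symm, hy, hx⟩⟩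

/-- **Rooted min-degree criterion.**  Every allowed branch abuts inside the finite set `W`, the root
`r ∈ W` carries an allowed branch, every other vertex of `W` carries two distinct allowed branches ⇒ some
allowed branch `bc` abuts to `vc₀`, its twin `bc₁` to `vc₁`, and `vc₁` is reached from `vc₀` avoiding `bc`.
(Follow an allowed branch at the root; if its edge separates, the far side is a smaller instance rooted
at the far end.) [cite: MochizukiSemiAnbd2006, Cor. 2.7(i) p.30] -/
theorem exists_nonseparating_of_two_branches (P : S.Edge → Prop) (W : Finset S.Vertex)
    (r : S.Vertex) (hr : r ∈ W)
    (hend : ∀ b : S.Branch, P (S.edgeOf b) → ∃ x ∈ W, S.abuts b = some x)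
    (hroot : ∃ b : S.Branch, P (S.edgeOf b) ∧ S.abuts b = some r)
    (hdeg : ∀ x ∈ W, x ≠ r → ∃ b b' : S.Branch, b ≠ b' ∧ P (S.edgeOf b) ∧ P (S.edgeOf b') ∧
      S.abuts b = some x ∧ S.abuts b' = some x) :
    ∃ (bc : S.Branch) (vc₀ vc₁ : S.Vertex) (bc₁ : S.Branch), P (S.edgeOf bc) ∧
      S.abuts bc = some vc₀ ∧ S.abuts bc₁ = some vc₁ ∧ bc₁ ≠ bc ∧ S.edgeOf bc₁ = S.edgeOf bc ∧
      Relation.ReflTransGen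
        (fun x y : S.Vertex => ∃ b b' : S.Branch, b ≠ bc ∧ b' ≠ bc ∧ S.edgeOf b = S.edgeOf b' ∧
          S.abuts b = some x ∧ S.abuts b' = some y) vc₀ vc₁ := by
  classical
  induction W using Finset.strongInduction generalizing P r with
  | H W ih =>
  obtain ⟨β, hβP, hβr⟩ := hroot
  obtain ⟨β₁, hβ₁, heβ⟩ := S.exists_twin β
  obtain ⟨u, huW, hβu⟩ := hend β₁ (heβ ▸ hβP)
  set R : S.Vertex → S.Vertex → Prop := fun x y => ∃ b b' : S.Branch,
    b ≠ β ∧ b' ≠ β ∧ S.edgeOf b = S.edgeOf b' ∧ S.abuts b = some x ∧ S.abuts b' = some y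
  by_cases hsep : Relation.ReflTransGen R r u
  · exact ⟨β, r, u, β₁, hβP, hβr, hβu, hβ₁, heβ, hsep⟩
  -- the edge of `β` separates: recurse into the far side `W'`, rooted at `u`
  have hur : u ≠ r := by rintro rfl; exact hsep Relation.ReflTransGen.refl
  have hβx : ∀ {b : S.Branch} {x : S.Vertex}, S.edgeOf b = S.edgeOf β → S.abuts b = some x →
      x ≠ r → x ≠ u → False := by
    intro b x hb hx hxr hxu
    rcases S.eq_or_eq_twin_of_edgeOf_eq hβ₁ heβ hb with rfl | rfl
    · exact hxr (Option.some_injective _ (hx.symm.trans hβr))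
    · exact hxu (Option.some_injective _ (hx.symm.trans hβu))
  let W' : Finset S.Vertex := W.filter fun x => Relation.ReflTransGen R u x
  haveI := S.symm_avoiding β
  have hrW' : r ∉ W' := fun h => hsep (Std.Symm.symm _ _ (Finset.mem_filter.mp h).2)
  have hW' : W' ⊂ W := Finset.ssubset_iff_subset_ne.mpr ⟨W.filter_subset _, fun h => hrW' (h ▸ hr)⟩
  have hmem : u ∈ W' := Finset.mem_filter.mpr ⟨huW, Relation.ReflTransGen.refl⟩
  refine (ih W' hW' (fun e => P e ∧ e ≠ S.edgeOf β ∧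
    ∃ (b₀ : S.Branch) (x₀ : S.Vertex), S.edgeOf b₀ = e ∧ S.abuts b₀ = some x₀ ∧
      Relation.ReflTransGen R u x₀) u hmem ?_ ?_ ?_).imp
    fun bc ⟨vc₀, vc₁, bc₁, hP, h⟩ => ⟨vc₀, vc₁, bc₁, hP.1, h⟩
  · -- every far-side branch abuts inside `W'`
    rintro b ⟨hbP, hbe, b₀, x₀, hb₀, hx₀, hux₀⟩
    obtain ⟨x, hxW, hbx⟩ := hend b hbP
    refine ⟨x, Finset.mem_filter.mpr ⟨hxW, hux₀.tail ⟨b₀, b, ?_, ?_, hb₀, hx₀, hbx⟩⟩, hbx⟩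
    · rintro rfl; exact hbe hb₀.symm
    · rintro rfl; exact hbe rfl
  · -- the new root `u` carries a far-side branch (of two allowed branches at `u` at most one is `β₁`)
    obtain ⟨b, b', hbb', hbP, hb'P, hbu, hb'u⟩ := hdeg u huW hur
    by_cases hb : S.edgeOf b = S.edgeOf β
    · refine ⟨b', ⟨hb'P, fun hb' => hbb' ?_, b', u, rfl, hb'u, .refl⟩, hb'u⟩
      rcases S.eq_or_eq_twin_of_edgeOf_eq hβ₁ heβ hb with rfl | rfl <;>
        rcases S.eq_or_eq_twin_of_edgeOf_eq hβ₁ heβ hb' with rfl | rfl <;>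
          first | rfl | exact (hur (Option.some_injective _ (hbu.symm.trans hβr))).elim |
            exact (hur (Option.some_injective _ (hb'u.symm.trans hβr))).elim
    · exact ⟨b, ⟨hbP, hb, b, u, rfl, hbu, .refl⟩, hbu⟩
  · intro x hx hxu -- the other far-side vertices keep their two allowed branches
    obtain ⟨hxW, hux⟩ := Finset.mem_filter.mp hx
    have hxr : x ≠ r := by rintro rfl; exact hrW' hx
    obtain ⟨b, b', hbb', hbP, hb'P, hbx, hb'x⟩ := hdeg x hxW hxr
    exact ⟨b, b', hbb', ⟨hbP, fun h => hβx h hbx hxr hxu, b, x, rfl, hbx, hux⟩,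
      ⟨hb'P, fun h => hβx h hb'x hxr hxu, b', x, rfl, hb'x, hux⟩, hbx, hb'x⟩

variable {S} in
/-- **Transport of avoiding walks** along maps of vertices and branches compatible with `edgeOf` and
`abuts` and injective on branches. [cite: MochizukiSemiAnbd2006, §1 p.11] -/
theorem reflTransGen_avoiding_map {S' : SemiGraph.{u}} (fV : S.Vertex → S'.Vertex)
    (fB : S.Branch → S'.Branch) (hfi : Function.Injective fB)
    (hfe : ∀ β β' : S.Branch, S.edgeOf β = S.edgeOf β' → S'.edgeOf (fB β) = S'.edgeOf (fB β'))
    (hfa : ∀ (β : S.Branch) (x : S.Vertex), S.abuts β = some x → S'.abuts (fB β) = some (fV x))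
    (bc : S.Branch) {x y : S.Vertex} (h : Relation.ReflTransGen
        (fun x y : S.Vertex => ∃ b b' : S.Branch, b ≠ bc ∧ b' ≠ bc ∧ S.edgeOf b = S.edgeOf b' ∧
          S.abuts b = some x ∧ S.abuts b' = some y) x y) :
    Relation.ReflTransGen
        (fun x y : S'.Vertex => ∃ b b' : S'.Branch, b ≠ fB bc ∧ b' ≠ fB bc ∧
          S'.edgeOf b = S'.edgeOf b' ∧ S'.abuts b = some x ∧ S'.abuts b' = some y) (fV x) (fV y) := by
  induction h with
  | refl => exact Relation.ReflTransGen.refl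
  | tail _ hst ih =>
    obtain ⟨b, b', hb, hb', he, hx, hy⟩ := hst
    exact ih.tail ⟨fB b, fB b', fun h => hb (hfi h), fun h => hb' (hfi h), hfe b b' he,
      hfa b _ hx, hfa b' _ hy⟩

/-- An avoiding walk for the twin `bc₁` is one for `bc`. [cite: MochizukiSemiAnbd2006, §1 p.11] -/
private theorem reflTransGen_avoiding_twin {bc bc₁ : S.Branch} (hne : bc₁ ≠ bc)
    (he : S.edgeOf bc₁ = S.edgeOf bc) {x y : S.Vertex} (h : Relation.ReflTransGen
        (fun x y : S.Vertex => ∃ b b' : S.Branch, b ≠ bc₁ ∧ b' ≠ bc₁ ∧ S.edgeOf b = S.edgeOf b' ∧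
          S.abuts b = some x ∧ S.abuts b' = some y) x y) :
    Relation.ReflTransGen
        (fun x y : S.Vertex => ∃ b b' : S.Branch, b ≠ bc ∧ b' ≠ bc ∧ S.edgeOf b = S.edgeOf b' ∧
          S.abuts b = some x ∧ S.abuts b' = some y) x y := by
  induction h with
  | refl => exact Relation.ReflTransGen.refl
  | tail _ hst ih =>
    obtain ⟨b, b', hb, hb', hbe, hx, hy⟩ := hst
    by_cases hbc : b = bc
    · subst hbc
      rcases S.eq_or_eq_twin_of_edgeOf_eq hne he hbe.symm with rfl | rfl
      · rw [Option.some_injective _ (hx.symm.trans hy)] at ih; exact ih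
      · exact absurd rfl hb'
    · refine ih.tail ⟨b, b', hbc, fun hb'c => ?_, hbe, hx, hy⟩
      subst hb'c
      rcases S.eq_or_eq_twin_of_edgeOf_eq hne he hbe with rfl | rfl
      exacts [hbc rfl, hb rfl]

/-- **Allowed degree ≥ 2 plus transitivity ⇒ every two-sided allowed edge is non-separating.**  Every
vertex of `W` carries two distinct allowed branches, every allowed branch abuts inside `W`, and any
allowed branch is carried onto the edge of any other by some `edgeOf`/`abuts`-compatible pair of maps
injective on branches ⇒ for every allowed `bc` abutting to `vc₀` with twin `bc₁` abutting to `vc₁`,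
`vc₁` is reached from `vc₀` avoiding `bc`. [cite: MochizukiSemiAnbd2006, Cor. 2.7(i) p.30] -/
theorem nonseparating_of_two_branches_of_transitive (P : S.Edge → Prop) (W : Finset S.Vertex)
    (hend : ∀ b : S.Branch, P (S.edgeOf b) → ∃ x ∈ W, S.abuts b = some x)
    (hdeg : ∀ x ∈ W, ∃ b b' : S.Branch, b ≠ b' ∧ P (S.edgeOf b) ∧ P (S.edgeOf b') ∧
      S.abuts b = some x ∧ S.abuts b' = some x)
    (htrans : ∀ b₁ b₂ : S.Branch, P (S.edgeOf b₁) → P (S.edgeOf b₂) →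
      ∃ (fV : S.Vertex → S.Vertex) (fB : S.Branch → S.Branch),
        (∀ β β' : S.Branch, S.edgeOf β = S.edgeOf β' → S.edgeOf (fB β) = S.edgeOf (fB β')) ∧
        (∀ (β : S.Branch) (x : S.Vertex), S.abuts β = some x → S.abuts (fB β) = some (fV x)) ∧
        Function.Injective fB ∧ S.edgeOf (fB b₁) = S.edgeOf b₂)
    (bc : S.Branch) (hbc : P (S.edgeOf bc)) {vc₀ vc₁ : S.Vertex} {bc₁ : S.Branch}
    (h₀ : S.abuts bc = some vc₀) (h₁ : S.abuts bc₁ = some vc₁) (hne : bc₁ ≠ bc)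
    (he : S.edgeOf bc₁ = S.edgeOf bc) : Relation.ReflTransGen
      (fun x y : S.Vertex => ∃ b b' : S.Branch, b ≠ bc ∧ b' ≠ bc ∧ S.edgeOf b = S.edgeOf b' ∧
        S.abuts b = some x ∧ S.abuts b' = some y) vc₀ vc₁ := by
  obtain ⟨x, hxW, hx⟩ := hend bc hbc
  obtain rfl : x = vc₀ := Option.some_injective _ (hx.symm.trans h₀)
  obtain ⟨bs, v₀, v₁, bs₁, hPs, hs₀, hs₁, hnes, hes, hwalk⟩ :=
    S.exists_nonseparating_of_two_branches P W x hxW hend ⟨bc, hbc, h₀⟩ fun y hy _ => hdeg y hy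
  obtain ⟨fV, fB, hfe, hfa, hfi, hfb⟩ := htrans bs bc hPs hbc
  have hw := reflTransGen_avoiding_map fV fB hfi hfe hfa bs hwalk
  have ht₀ := hfa bs v₀ hs₀; have ht₁ := hfa bs₁ v₁ hs₁
  have hnet : fB bs₁ ≠ fB bs := fun h => hnes (hfi h)
  rcases S.eq_or_eq_twin_of_edgeOf_eq hne he hfb with hbs | hbs <;>
    rcases S.eq_or_eq_twin_of_edgeOf_eq hne he ((hfe bs₁ bs hes).trans hfb) with hbs₁ | hbs₁
  · exact absurd (hbs₁.trans hbs.symm) hnet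
  · rw [hbs] at hw ht₀; rw [hbs₁] at ht₁
    obtain rfl := Option.some_injective _ (ht₀.symm.trans h₀)
    rw [Option.some_injective _ (ht₁.symm.trans h₁)] at hw; exact hw
  · rw [hbs] at hw ht₀; rw [hbs₁] at ht₁
    obtain rfl := Option.some_injective _ (ht₀.symm.trans h₁)
    obtain rfl := Option.some_injective _ (ht₁.symm.trans h₀)
    haveI := S.symm_avoiding bc
    exact Std.Symm.symm _ _ (S.reflTransGen_avoiding_twin hne he hw)
  · exact absurd (hbs₁.trans hbs.symm) hnet

end Literature.AnabelianGeometry.SemiGraphs.SemiGraph
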